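import Summits.KontsevichZagierPeriods.KontsevichZagierPeriods.Theorems.SoloInformedNLSheets
import Summits.KontsevichZagierPeriods.KontsevichZagierPeriods.Theorems.SoloInformedCADCells
import HarnessLib
import HarnessLib.Audit

/-!
# SoloInformed — cell data for the Newton–Leibniz elimination: sign sets, adapted cells, sheet data on open cells (file 4a)

Solo programme `solo-KontsevichZagierPeriods-informed`, session s245 (K-NF, `paper/nl-elimination.md`
§7.2, FILE 4 PLAN (refined s245), part 4a).

Bookkeeping lemmas for the assembly of THEOREM NF:

* sign sets `{x ∈ s | 0 < f x}`, `{x ∈ s | f x < 0}`, `{x ∈ s | f x = 0}` of a `ℚ`-semialgebraic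
  function are `ℚ`-semialgebraic (graph elimination, Tarski–Seidenberg);
* cells of a decomposition ADAPTED to a set `s` (i.e. `s` is a union of cells) are contained in `s`
  or disjoint from it; an OPEN cell inside `B` lies inside any adapted `A ⊆ B` with `B \\ A` null,
  and inside exactly one of three adapted sets covering it;
* an open subset of the closed band `{a ≤ t ≤ b}` lies in the open band `{a < t < b}`;
* on an open piece of the open band where the primitive `F` is differentiable, the Newton–Leibniz
  fibre hypothesis identifies the integrand with `∂_t F = fderiv F · e_last`
  (`soloInformed_nl_sheetData`), which is the input of the sheets of file 3c.

References: Bochnak–Coste–Roy (1998), Thm. 2.2.1; Basu–Pollack–Roy (2006), §5.1;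
M. Kontsevich, D. Zagier, *Periods* (2001), §1.2; this work (`paper/nl-elimination.md` §7.2).
-/

noncomputable section

open scoped BigOperators Topology ContDiff

namespace Summit.KontsevichZagierPeriods.KontsevichZagierPeriods.Theorems

open Set MeasureTheory Filter Function
open Literature.ModelTheory.ExponentialFields
open Literature.NumberTheory.Transcendental Literature.NumberTheory.Transcendental.KZ

variable {n : ℕ}

/-! ### Sign sets -/

/-- The half-space `{z | 0 < z_last}` is `ℚ`-semialgebraic. -/
theorem soloInformed_isSemialgebraic_setOf_last_pos :
    IsSemialgebraic ℚ {z : Fin (n + 1) → ℝ | 0 < z (Fin.last n)} := by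
  convert isSemialgebraic_setOf_eval_pos (k := ℚ) (R := ℝ)
    (MvPolynomial.X (Fin.last n) : MvPolynomial (Fin (n + 1)) ℚ) using 2 with z
  simp

/-- The half-space `{z | z_last < 0}` is `ℚ`-semialgebraic. -/
theorem soloInformed_isSemialgebraic_setOf_last_neg :
    IsSemialgebraic ℚ {z : Fin (n + 1) → ℝ | z (Fin.last n) < 0} := by
  convert isSemialgebraic_setOf_eval_pos (k := ℚ) (R := ℝ)
    (-MvPolynomial.X (Fin.last n) : MvPolynomial (Fin (n + 1)) ℚ) using 2 with z
  simp

/-- The hyperplane `{z | z_last = 0}` is `ℚ`-semialgebraic. -/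
theorem soloInformed_isSemialgebraic_setOf_last_eq_zero :
    IsSemialgebraic ℚ {z : Fin (n + 1) → ℝ | z (Fin.last n) = 0} := by
  convert isSemialgebraic_setOf_eval_eq_zero (k := ℚ) (R := ℝ)
    (MvPolynomial.X (Fin.last n) : MvPolynomial (Fin (n + 1)) ℚ) using 2 with z
  simp

/-- **Positivity set of a semialgebraic function is semialgebraic.** [BCR 1998, Thm. 2.2.1] -/
theorem soloInformed_isSemialgebraic_sep_pos {s : Set (Fin n → ℝ)} {f : (Fin n → ℝ) → ℝ}
    (hf : IsSemialgebraicFunOn ℚ s f) : IsSemialgebraic ℚ {x | x ∈ s ∧ 0 < f x} := by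
  convert hf.isSemialgebraic_sep_snoc_mem tarski_seidenberg_real_holds
    soloInformed_isSemialgebraic_setOf_last_pos using 2 with x
  simp

/-- **Negativity set of a semialgebraic function is semialgebraic.** [BCR 1998, Thm. 2.2.1] -/
theorem soloInformed_isSemialgebraic_sep_neg {s : Set (Fin n → ℝ)} {f : (Fin n → ℝ) → ℝ}
    (hf : IsSemialgebraicFunOn ℚ s f) : IsSemialgebraic ℚ {x | x ∈ s ∧ f x < 0} := by
  convert hf.isSemialgebraic_sep_snoc_mem tarski_seidenberg_real_holds
    soloInformed_isSemialgebraic_setOf_last_neg using 2 with x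
  simp

/-- **Zero set of a semialgebraic function is semialgebraic.** [BCR 1998, Thm. 2.2.1] -/
theorem soloInformed_isSemialgebraic_sep_eq_zero {s : Set (Fin n → ℝ)} {f : (Fin n → ℝ) → ℝ}
    (hf : IsSemialgebraicFunOn ℚ s f) : IsSemialgebraic ℚ {x | x ∈ s ∧ f x = 0} := by
  convert hf.isSemialgebraic_sep_snoc_mem tarski_seidenberg_real_holds
    soloInformed_isSemialgebraic_setOf_last_eq_zero using 2 with x
  simp

/-! ### Adapted cells -/

/-- **A cell of a partition adapted to `s` lies in `s` or is disjoint from it.**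
[BPR 2006, §5.1] -/
theorem soloInformed_cell_subset_or_disjoint {α : Type*} {𝒯 𝒞 : Finset (Set α)}
    (hpart : Setoid.IsPartition (𝒯 : Set (Set α))) (h𝒞 : 𝒞 ⊆ 𝒯) {s : Set α}
    (hU : ⋃₀ (𝒞 : Set (Set α)) = s) {T : Set α} (hT : T ∈ 𝒯) : T ⊆ s ∨ Disjoint T s := by
  by_cases h : Disjoint T s
  · exact Or.inr h
  refine Or.inl ?_
  obtain ⟨z, hzT, hzs⟩ := not_disjoint_iff.1 h
  rw [← hU] at hzs
  obtain ⟨C, hC, hzC⟩ := mem_sUnion.1 hzs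
  have hTC : T = C := by
    by_contra hne
    exact (hpart.pairwiseDisjoint hT (h𝒞 hC) hne).le_bot ⟨hzT, hzC⟩
  rw [hTC, ← hU]
  exact subset_sUnion_of_mem hC

/-- A cell adapted to `s` which meets `s` lies in `s`. [BPR 2006, §5.1] -/
theorem soloInformed_cell_subset_of_not_disjoint {α : Type*} {𝒯 𝒞 : Finset (Set α)}
    (hpart : Setoid.IsPartition (𝒯 : Set (Set α))) (h𝒞 : 𝒞 ⊆ 𝒯) {s : Set α}
    (hU : ⋃₀ (𝒞 : Set (Set α)) = s) {T : Set α} (hT : T ∈ 𝒯) (h : ¬Disjoint T s) : T ⊆ s :=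
  (soloInformed_cell_subset_or_disjoint hpart h𝒞 hU hT).resolve_right h

/-- **An open cell inside `B` lies inside an adapted `A ⊆ B` with `B \\ A` null** (else it would
be a null open nonempty set). [BPR 2006, §5.1; folklore] -/
theorem soloInformed_openCell_subset_of_null_diff {𝒯 𝒞 : Finset (Set (Fin n → ℝ))}
    (h𝒯 : IsCylindricalDecomposition ℚ n 𝒯) (h𝒞 : 𝒞 ⊆ 𝒯) {A B : Set (Fin n → ℝ)}
    (hU : ⋃₀ (𝒞 : Set (Set (Fin n → ℝ))) = A) (hnull : volume (B \ A) = 0) {T : Set (Fin n → ℝ)}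
    (hT : T ∈ 𝒯) (hopen : IsOpen T) (hTB : T ⊆ B) : T ⊆ A := by
  rcases soloInformed_cell_subset_or_disjoint h𝒯.isPartition h𝒞 hU hT with h | h
  · exact h
  · exfalso
    refine soloInformed_cad_volume_ne_zero_of_isOpen h𝒯 hT hopen (measure_mono_null ?_ hnull)
    exact fun z hz => ⟨hTB hz, fun hzA => h.le_bot ⟨hz, hzA⟩⟩

/-- **Trichotomy**: a nonempty cell inside `P ∪ N ∪ Z`, the decomposition being adapted to each
of `P`, `N`, `Z`, lies inside one of them. [BPR 2006, §5.1] -/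
theorem soloInformed_cell_subset_three {α : Type*} {𝒯 𝒞P 𝒞N 𝒞Z : Finset (Set α)}
    (hpart : Setoid.IsPartition (𝒯 : Set (Set α))) {P N Z : Set α}
    (hP : 𝒞P ⊆ 𝒯) (hUP : ⋃₀ (𝒞P : Set (Set α)) = P) (hN : 𝒞N ⊆ 𝒯)
    (hUN : ⋃₀ (𝒞N : Set (Set α)) = N) (hZ : 𝒞Z ⊆ 𝒯) (hUZ : ⋃₀ (𝒞Z : Set (Set α)) = Z)
    {T : Set α} (hT : T ∈ 𝒯) (hne : T.Nonempty) (hsub : T ⊆ P ∪ N ∪ Z) :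
    T ⊆ P ∨ T ⊆ N ∨ T ⊆ Z := by
  obtain ⟨z, hz⟩ := hne
  rcases hsub hz with (hzP | hzN) | hzZ
  · exact Or.inl (soloInformed_cell_subset_of_not_disjoint hpart hP hUP hT
      (not_disjoint_iff.2 ⟨z, hz, hzP⟩))
  · exact Or.inr (Or.inl (soloInformed_cell_subset_of_not_disjoint hpart hN hUN hT
      (not_disjoint_iff.2 ⟨z, hz, hzN⟩)))
  · exact Or.inr (Or.inr (soloInformed_cell_subset_of_not_disjoint hpart hZ hUZ hT
      (not_disjoint_iff.2 ⟨z, hz, hzZ⟩)))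

/-! ### Open pieces of the band -/

/-- The fibre of an open set is open. -/
theorem soloInformed_isOpen_fibre {D : Set (Fin (n + 1) → ℝ)} (hD : IsOpen D) (x : Fin n → ℝ) :
    IsOpen (soloInformedFibre D x) := by
  have hc : Continuous fun t : ℝ => (Fin.snoc x t : Fin (n + 1) → ℝ) := by
    refine continuous_pi fun i => ?_
    induction i using Fin.lastCases with
    | last => simp only [Fin.snoc_last]; exact continuous_id
    | cast k => simp only [Fin.snoc_castSucc]; exact continuous_const
  exact hD.preimage hc

/-- **An open subset of the closed band lies in the open band**: if `D` is open and
`D ⊆ {(x,t) | x ∈ τ, a x ≤ t ≤ b x}` then `a x < t < b x` on `D`. [folklore] -/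
theorem soloInformed_mem_openBand_of_isOpen {D : Set (Fin (n + 1) → ℝ)} (hD : IsOpen D)
    {τ : Set (Fin n → ℝ)} {a b : (Fin n → ℝ) → ℝ}
    (hDB : D ⊆ {z | Fin.init z ∈ τ ∧ a (Fin.init z) ≤ z (Fin.last n) ∧
      z (Fin.last n) ≤ b (Fin.init z)}) {z : Fin (n + 1) → ℝ} (hz : z ∈ D) :
    Fin.init z ∈ τ ∧ a (Fin.init z) < z (Fin.last n) ∧ z (Fin.last n) < b (Fin.init z) := by
  refine ⟨(hDB hz).1, ?_⟩
  have hsub : soloInformedFibre D (Fin.init z) ⊆ Icc (a (Fin.init z)) (b (Fin.init z)) := by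
    intro t ht
    have h := hDB ht
    simp only [mem_setOf_eq, Fin.init_snoc, Fin.snoc_last] at h
    exact ⟨h.2.1, h.2.2⟩
  have hint : soloInformedFibre D (Fin.init z) ⊆ Ioo (a (Fin.init z)) (b (Fin.init z)) := by
    rw [← interior_Icc]
    exact (soloInformed_isOpen_fibre hD _).subset_interior_iff.2 hsub
  exact hint (soloInformed_last_mem_fibre hz)

/-! ### Sheet data on open pieces -/

/-- Differentiability at the points of an open set from `C^∞` on it. -/
theorem soloInformed_hasFDerivAt_of_contDiffOn {G : Set (Fin (n + 1) → ℝ)} (hG : IsOpen G)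
    {F : (Fin (n + 1) → ℝ) → ℝ} (hF : ContDiffOn ℝ ∞ F G) {z : Fin (n + 1) → ℝ} (hz : z ∈ G) :
    HasFDerivAt F (fderiv ℝ F z) z :=
  ((hF.differentiableOn (by simp)).differentiableAt (hG.mem_nhds hz)).hasFDerivAt

/-- **Sheet data from the Newton–Leibniz hypothesis.** Let `ρ = [D, f|_D]` be a piece with
`D` inside the open band over `τ` and inside an open set `G` where `F` is `C^∞`, and suppose the
Newton–Leibniz fibre hypothesis `∂_t F(x,t) = f(x,t)` on the open band. Then `F` has the Fréchet
derivative `fderiv ℝ F` at the points of `D` and `ρ.integrand z = fderiv ℝ F z e_last` on `D` —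
the hypotheses `hd`, `hjac` of `soloInformedPosSheet` / `soloInformedNegSheet`.
[Kontsevich–Zagier 2001, §1.2, rule 3); folklore] -/
theorem soloInformed_nl_sheetData (ρ : IntegralRep (n + 1)) {G : Set (Fin (n + 1) → ℝ)}
    (hG : IsOpen G) {F : (Fin (n + 1) → ℝ) → ℝ} (hF : ContDiffOn ℝ ∞ F G) (hρG : ρ.domain ⊆ G)
    {τ : Set (Fin n → ℝ)} {a b : (Fin n → ℝ) → ℝ} {f : (Fin (n + 1) → ℝ) → ℝ}
    (hρB : ∀ z ∈ ρ.domain,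
      Fin.init z ∈ τ ∧ a (Fin.init z) < z (Fin.last n) ∧ z (Fin.last n) < b (Fin.init z))
    (hNL : ∀ x ∈ τ, ∀ t ∈ Ioo (a x) (b x),
      HasDerivAt (fun s : ℝ => F (Fin.snoc x s)) (f (Fin.snoc x t)) t)
    (hint : ∀ z ∈ ρ.domain, ρ.integrand z = f z) :
    (∀ z ∈ ρ.domain, HasFDerivAt F (fderiv ℝ F z) z) ∧
      ∀ z ∈ ρ.domain, ρ.integrand z = fderiv ℝ F z (Pi.single (Fin.last n) 1) := by
  have hd : ∀ z ∈ ρ.domain, HasFDerivAt F (fderiv ℝ F z) z := fun z hz =>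
    soloInformed_hasFDerivAt_of_contDiffOn hG hF (hρG hz)
  refine ⟨hd, fun z hz => ?_⟩
  obtain ⟨hx, ha, hb⟩ := hρB z hz
  have hfib := hNL (Fin.init z) hx (z (Fin.last n)) ⟨ha, hb⟩
  rw [Fin.snoc_init_self] at hfib
  rw [hint z hz, soloInformed_fderiv_single_last_eq (hd z hz) hfib]

/-- The same for a piece given as a cell representation `soloInformedCadRep r C` of the
Newton–Leibniz representation `r = [B, f]` on an open cell `C ⊆ B ∩ G`. -/
theorem soloInformed_nl_sheetData_cadRep (r : IntegralRep (n + 1)) {C G : Set (Fin (n + 1) → ℝ)}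
    (hC : IsSemialgebraic ℚ C) (hCr : C ⊆ r.domain) (hCo : IsOpen C) (hG : IsOpen G)
    {F : (Fin (n + 1) → ℝ) → ℝ} (hF : ContDiffOn ℝ ∞ F G) (hCG : C ⊆ G)
    {τ : Set (Fin n → ℝ)} {a b : (Fin n → ℝ) → ℝ}
    (hdom : r.domain = {z : Fin (n + 1) → ℝ | Fin.init z ∈ τ ∧ a (Fin.init z) ≤ z (Fin.last n) ∧
      z (Fin.last n) ≤ b (Fin.init z)})
    (hNL : ∀ x ∈ τ, ∀ t ∈ Ioo (a x) (b x),
      HasDerivAt (fun s : ℝ => F (Fin.snoc x s)) (r.integrand (Fin.snoc x t)) t) :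
    (∀ z ∈ (soloInformedCadRep r C).domain, HasFDerivAt F (fderiv ℝ F z) z) ∧
      ∀ z ∈ (soloInformedCadRep r C).domain,
        (soloInformedCadRep r C).integrand z = fderiv ℝ F z (Pi.single (Fin.last n) 1) := by
  have hdomC : (soloInformedCadRep r C).domain = C := soloInformed_cadRep_domain r hC hCr
  refine soloInformed_nl_sheetData (soloInformedCadRep r C) hG hF (by rw [hdomC]; exact hCG)
    (τ := τ) (a := a) (b := b) (f := r.integrand) (fun z hz => ?_) hNL fun z _ => by
      rw [soloInformed_cadRep_integrand]
  rw [hdomC] at hz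
  exact soloInformed_mem_openBand_of_isOpen hCo (hdom ▸ hCr) hz

end Summit.KontsevichZagierPeriods.KontsevichZagierPeriods.Theorems
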